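import Mathlib
import Summits.ValiantsHypothesis.ValiantsHypothesis.Theorems.LiouvilleSarnakAlignedCutRank
import Summits.ValiantsHypothesis.ValiantsHypothesis.Theorems.LiouvilleSarnakLiouvilleCutRankInterleavedKernel
import HarnessLib

/-!
# Route LiouvilleSarnak — crux `LiouvilleCutRank` (stmt-ValiantsHypothesis-14775):
# the FINELY INTERLEAVED PROTOTYPE `(CR)^n` HAS UNBOUNDED CUT RANK (unconditional)

The census on the item (leafhand-2 g0–g4, leafhand-3 g0–g1) isolated as the open core of the crux the class
of finely interleaved cut words, with prototype the bit-interleaving cut (column bit `i` at position `2i`, row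
bit `i` at position `2i+1`), whose cut matrix at level `n` is `M_n(r, c) = λ(1 + 2 P(r) + P(c))`,
`P(v) = Σ_i [v i] 4^i` (`…InterleavedKernel.cutNumber_interleaved`); `…InterleavedKernel` reduced it to
"sparse kernel distinctness" and `…InterleavedSymmetries` recorded the carry-free identities coming from
`λ(2m) = -λ(m)`, `λ(3m) = -λ(m)`, `λ(4m) = λ(m)`, noting that an odd-prime input is necessary
(`…AutomaticityBarrier`: with `λ(2m) = -λ(m)` alone, rank ONE is consistent).

This file SETTLES the prototype: for every `W`, for all large `n`, the interleaved cut matrix of `λ` has rank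
`≥ W` (`interleavedCutRank`).  The proof is elementary and uses exactly `λ(4m) = λ(m)`, `λ(3m) = -λ(m)` and
`λ ≠ 0`:

* §1 `infinite_range_of_oddRows` — ★ the combinatorial core.  Let `A : ℕ → ℕ → ℤ` satisfy
  (F) `A (2x+1) (2y+1) = A x y`, (T₃) `A (2y+1) (2y) = -A 0 (2y)` and `A 0 (2y) ≠ 0`.  Then `A` has
  INFINITELY many distinct rows.  (If the set `𝓡` of rows were finite: by (F) every row is the restriction
  `ρ ↦ (y ↦ ρ(2y+1))` of an ODD-indexed row, so the odd-indexed rows `𝓞 ⊆ 𝓡` satisfy `#𝓡 ≤ #𝓞`, whence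
  `𝓞 = 𝓡 ∋ A 0`: some odd row `A (2x+1)` equals the row `A 0`; evaluating at the column `2x` contradicts
  (T₃).)
* §2 `exists_spread`, `spread_ofBits` — the digit-spreading bijection `e : ℕ → E` onto the base-`4`
  `{0,1}`-digit numbers (`e 0 = 0`, `e(2x) = 4 e(x)`, `e(2x+1) = 4 e(x) + 1`), and `e (Nat.ofBits r) = P(r)`.
* §3 `liouville_spread_hyps`, `infinite_interleavedRows` — for `A x y = λ(1 + 2 e(x) + e(y))`:
  (F) is `λ(4m) = λ(m)` (`1 + 2(4e(x)+1) + 4e(y)+1 = 4(1 + 2e(x) + e(y))`), (T₃) is `λ(3m) = -λ(m)`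
  (`1 + 2(4e(y)+1) + 4e(y) = 3(1 + 4e(y))`); so the infinite interleaved matrix `(λ(1 + 2R + C))_{R, C ∈ E}`
  has infinitely many distinct rows.
* §4 ★ `interleavedCutRank` — `∀ W, ∃ n₀, ∀ n ≥ n₀`, the bit-interleaving cut matrix `M_π` at level `n` has
  `W ≤ rank M_π`: `2^W` pairwise distinct infinite rows are distinguished at finitely many columns, hence give
  `2^W` distinct rows of `M_n` for all large `n`, and a `±1` matrix with `2^W` distinct rows has rank `≥ W`
  (`LiouvilleSarnakAligned.card_image_row_le_two_pow_rank`).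

So Class A's prototype is CLOSED; the same argument applies verbatim to any sign function `f` with
`f(4m) = f(m)`, `f(3m) = -f(m)` (e.g. the completely multiplicative twisted characters of the
`…MultiplicativeBarrier`, whose ALIGNED ranks are bounded — the interleaved cut sees the prime `3`).
Honest framing: one explicit cut family of the crux; the crux `LiouvilleCutRank` (ALL balanced cuts),
`DigitalBilinearLiouville` and `AlgebraicSarnak` stay OPEN; nothing here bears on `VP ≠ VNP`.  No definitions
(the spreading map is produced by `∃`); imports the tree's `…AlignedCutRank` and `…InterleavedKernel`.
-/

set_option linter.dupNamespace false

noncomputable section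

namespace Summit.ValiantsHypothesis.ValiantsHypothesis.Theorems.LiouvilleSarnakLiouvilleCutRank.InterleavedUnbounded

open ArithmeticFunction Finset

open Summit.ValiantsHypothesis.ValiantsHypothesis.Theorems.LiouvilleSarnakAligned
  (card_image_row_le_two_pow_rank)
open Summit.ValiantsHypothesis.ValiantsHypothesis.Theorems.LiouvilleSarnakLiouvilleCutRank.Interleaved
  (cutNumber_interleaved exists_interleavedCut)

/-! ### §1 The combinatorial core: (F) + (T₃) force infinitely many rows -/

/-- ★ **Infinitely many rows.**  If `A : ℕ → ℕ → ℤ` satisfies `A (2x+1) (2y+1) = A x y` (every row is the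
odd-column restriction of an odd-indexed row), `A (2y+1) (2y) = -A 0 (2y)` and `A 0 (2y) ≠ 0`, then the set of
rows `{A x : x ∈ ℕ}` is infinite: otherwise the odd-indexed rows, whose restrictions exhaust all rows, would be
ALL the rows, so some odd row `A (2x+1)` would equal `A 0`, contradicting the second identity at column `2x`.
[this file] -/
theorem infinite_range_of_oddRows (A : ℕ → ℕ → ℤ)
    (hF : ∀ x y, A (2 * x + 1) (2 * y + 1) = A x y)
    (h3 : ∀ y, A (2 * y + 1) (2 * y) = -A 0 (2 * y))
    (hne : ∀ y, A 0 (2 * y) ≠ 0) : (Set.range A).Infinite := by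
  classical
  intro hfin
  have hOfin : (Set.range fun x => A (2 * x + 1)).Finite :=
    hfin.subset (by rintro _ ⟨x, rfl⟩; exact ⟨2 * x + 1, rfl⟩)
  -- every row is the odd-column restriction of an odd-indexed row
  have hsub : hfin.toFinset ⊆ hOfin.toFinset.image (fun ρ : ℕ → ℤ => fun y => ρ (2 * y + 1)) := by
    intro ρ hρ
    rw [Set.Finite.mem_toFinset] at hρ
    obtain ⟨x, rfl⟩ := hρ
    refine Finset.mem_image.mpr ⟨A (2 * x + 1), ?_, ?_⟩
    · rw [Set.Finite.mem_toFinset]; exact ⟨x, rfl⟩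
    · funext y; exact hF x y
  have hOR : hOfin.toFinset ⊆ hfin.toFinset := by
    intro ρ hρ
    rw [Set.Finite.mem_toFinset] at hρ
    obtain ⟨x, rfl⟩ := hρ
    rw [Set.Finite.mem_toFinset]; exact ⟨2 * x + 1, rfl⟩
  have hcard : hfin.toFinset.card ≤ hOfin.toFinset.card :=
    (Finset.card_le_card hsub).trans Finset.card_image_le
  have hEq : hOfin.toFinset = hfin.toFinset := Finset.eq_of_subset_of_card_le hOR hcard
  have h0 : A 0 ∈ hOfin.toFinset := by
    rw [hEq, Set.Finite.mem_toFinset]; exact ⟨0, rfl⟩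
  rw [Set.Finite.mem_toFinset] at h0
  obtain ⟨x, hx⟩ := h0
  have h1 := congrFun hx (2 * x)
  simp only at h1
  rw [h3] at h1
  exact hne x (by linarith)

/-! ### §2 The digit-spreading map `e : ℕ ≃ E` (`E` = base-`4` numbers with digits in `{0,1}`) -/

/-- There is `e : ℕ → ℕ` with `e 0 = 0`, `e (2x) = 4 e x`, `e (2x+1) = 4 e x + 1` (spread the binary digits of
`x` to the even positions; explicitly `Nat.binaryRec 0 (fun b _ a => b.toNat + 4 a)`). [folklore] -/
theorem exists_spread : ∃ e : ℕ → ℕ, e 0 = 0 ∧ (∀ x, e (2 * x) = 4 * e x) ∧ (∀ x, e (2 * x + 1) = 4 * e x + 1) := by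
  refine ⟨Nat.binaryRec (motive := fun _ => ℕ) (0 : ℕ) (fun b _ a => b.toNat + 4 * a), ?_, ?_, ?_⟩
  · exact Nat.binaryRec_zero _ _
  · intro x
    have h : Nat.binaryRec (motive := fun _ => ℕ) (0 : ℕ) (fun b _ a => b.toNat + 4 * a) (Nat.bit false x) =
        false.toNat + 4 * Nat.binaryRec (motive := fun _ => ℕ) (0 : ℕ) (fun b _ a => b.toNat + 4 * a) x :=
      Nat.binaryRec_eq (motive := fun _ => ℕ) false x (Or.inl rfl)
    rw [Nat.bit_false_apply] at h
    rw [h]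
    simp
  · intro x
    have h : Nat.binaryRec (motive := fun _ => ℕ) (0 : ℕ) (fun b _ a => b.toNat + 4 * a) (Nat.bit true x) =
        true.toNat + 4 * Nat.binaryRec (motive := fun _ => ℕ) (0 : ℕ) (fun b _ a => b.toNat + 4 * a) x :=
      Nat.binaryRec_eq (motive := fun _ => ℕ) true x (Or.inl rfl)
    rw [Nat.bit_true_apply] at h
    rw [h]
    simp only [Bool.toNat_true]
    ring

/-- For such an `e`: `e (Nat.ofBits r) = P(r) = Σ_i [r i] 4^i`. [folklore] -/
theorem spread_ofBits (e : ℕ → ℕ) (hz : e 0 = 0) (he0 : ∀ x, e (2 * x) = 4 * e x)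
    (he1 : ∀ x, e (2 * x + 1) = 4 * e x + 1) :
    ∀ (n : ℕ) (r : Fin n → Bool), e (Nat.ofBits r) = ∑ i : Fin n, (r i).toNat * 4 ^ (i : ℕ) := by
  intro n
  induction n with
  | zero => intro r; simp [hz]
  | succ n ih =>
    intro r
    rw [Nat.ofBits_succ, Fin.sum_univ_succ]
    have hih := ih (r ∘ Fin.succ)
    have htail : (∑ i : Fin n, (r (Fin.succ i)).toNat * 4 ^ ((Fin.succ i : Fin (n + 1)) : ℕ)) =
        4 * ∑ i : Fin n, ((r ∘ Fin.succ) i).toNat * 4 ^ (i : ℕ) := by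
      rw [Finset.mul_sum]
      refine Finset.sum_congr rfl fun i _ => ?_
      simp only [Fin.val_succ, pow_succ, Function.comp_apply]
      ring
    rw [htail, ← hih]
    cases r 0
    · simp only [Bool.toNat_false, add_zero, Fin.val_zero, pow_zero, mul_one, zero_add]
      exact he0 _
    · simp only [Bool.toNat_true, Fin.val_zero, pow_zero, mul_one]
      rw [he1]; ring

/-! ### §3 The identities for `A x y = λ(1 + 2 e x + e y)` -/

/-- `λ(3m) = -λ(m)` and `λ(4m) = λ(m)`. [folklore] -/
theorem liouville_three_four (m : ℕ) : liouville (3 * m) = -liouville m ∧ liouville (4 * m) = liouville m := by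
  have h2 : liouville 2 = -1 := by
    rw [liouville_apply two_ne_zero, cardFactors_apply_prime Nat.prime_two]; norm_num
  have h3 : liouville 3 = -1 := by
    rw [liouville_apply (by norm_num), cardFactors_apply_prime Nat.prime_three]; norm_num
  have h4 : liouville 4 = 1 := by
    rw [show (4 : ℕ) = 2 * 2 by norm_num, liouville_apply_mul, h2]; norm_num
  refine ⟨?_, ?_⟩
  · rw [liouville_apply_mul, h3]; ring
  · rw [liouville_apply_mul, h4]; ring

/-- For `A x y = λ(1 + 2 e(x) + e(y))`: (F) `A (2x+1) (2y+1) = A x y` (`λ(4m) = λ(m)`), (T₃)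
`A (2y+1) (2y) = -A 0 (2y)` (`1 + 2(4e(y)+1) + 4e(y) = 3 (1 + 4 e(y))`, `λ(3) = -1`), and `A 0 (2y) ≠ 0`.
[this file] -/
theorem liouville_spread_hyps (e : ℕ → ℕ) (hz : e 0 = 0) (he0 : ∀ x, e (2 * x) = 4 * e x)
    (he1 : ∀ x, e (2 * x + 1) = 4 * e x + 1) :
    (∀ x y, liouville (1 + 2 * e (2 * x + 1) + e (2 * y + 1)) = liouville (1 + 2 * e x + e y)) ∧
    (∀ y, liouville (1 + 2 * e (2 * y + 1) + e (2 * y)) = -liouville (1 + 2 * e 0 + e (2 * y))) ∧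
    (∀ y, liouville (1 + 2 * e 0 + e (2 * y)) ≠ 0) := by
  refine ⟨fun x y => ?_, fun y => ?_, fun y => liouville_ne_zero (by omega)⟩
  · rw [he1, he1, show 1 + 2 * (4 * e x + 1) + (4 * e y + 1) = 4 * (1 + 2 * e x + e y) by ring]
    exact (liouville_three_four _).2
  · rw [he1, he0, hz, show 1 + 2 * (4 * e y + 1) + 4 * e y = 3 * (1 + 2 * 0 + 4 * e y) by ring]
    exact (liouville_three_four _).1

/-- ★ **The infinite interleaved matrix of `λ` has infinitely many distinct rows**: for the spreading map `e`,
the rows `y ↦ λ(1 + 2 e(x) + e(y))`, `x ∈ ℕ` — i.e. the rows `C ↦ λ(1 + 2R + C)` (`R, C` base-`4` numbers with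
digits in `{0,1}`) — form an infinite set. [this file] -/
theorem infinite_interleavedRows (e : ℕ → ℕ) (hz : e 0 = 0) (he0 : ∀ x, e (2 * x) = 4 * e x)
    (he1 : ∀ x, e (2 * x + 1) = 4 * e x + 1) :
    (Set.range fun x y => liouville (1 + 2 * e x + e y)).Infinite := by
  obtain ⟨hF, h3, hne⟩ := liouville_spread_hyps e hz he0 he1
  exact infinite_range_of_oddRows (fun x y => liouville (1 + 2 * e x + e y)) hF h3 hne

/-! ### §4 The prototype `(CR)^n` of Class A has unbounded cut rank -/

/-- ★★ **The bit-interleaving cut has unbounded rank.**  For every `W` there is `n₀` such that for all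
`n ≥ n₀` the cut matrix `M_π(r, c) = λ(N_π(r, c) + 1)` of the bit-interleaving cut `π` at level `n` (row bit
`i` at position `2i+1`, column bit `i` at position `2i`) has rank `≥ W` over `ℂ` — the instance of the crux
`LiouvilleCutRank` for this cut family, proved unconditionally from `λ(4m) = λ(m)`, `λ(3m) = -λ(m)`, `λ ≠ 0`.
[this file] -/
theorem interleavedCutRank (W : ℕ) : ∃ n₀ : ℕ, ∀ n ≥ n₀, ∀ π : Fin n ⊕ Fin n ≃ Fin (2 * n),
    (∀ i : Fin n, (π (Sum.inl i) : ℕ) = 2 * i + 1 ∧ (π (Sum.inr i) : ℕ) = 2 * i) →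
      W ≤ (Matrix.of fun r c : Fin n → Bool =>
        (((liouville (Nat.ofBits (fun k : Fin (2 * n) => Sum.elim r c (π.symm k)) + 1) : ℤ) : ℂ))).rank := by
  classical
  obtain ⟨e, hz, he0, he1⟩ := exists_spread
  have hinf := infinite_interleavedRows e hz he0 he1
  -- `2^W` pairwise distinct infinite rows, with representatives and separating columns
  obtain ⟨T, hTsub, hTcard⟩ := hinf.exists_subset_card_eq (2 ^ W)
  have hrep : ∀ ρ ∈ T, ∃ x : ℕ, (fun y => liouville (1 + 2 * e x + e y)) = ρ := fun ρ hρ =>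
    hTsub (Finset.mem_coe.mpr hρ)
  choose! X hX using hrep
  have hsep : ∀ ρ ∈ T, ∀ ρ' ∈ T, ρ ≠ ρ' → ∃ y : ℕ, ρ y ≠ ρ' y := fun ρ _ ρ' _ h =>
    Function.ne_iff.mp h
  choose! Y hY using hsep
  -- a level above all representatives and separating columns
  refine ⟨T.sup X + T.sup (fun ρ => T.sup (Y ρ)) + 1, fun n hn π hπ => ?_⟩
  have h2n : T.sup X + T.sup (fun ρ => T.sup (Y ρ)) < 2 ^ n :=
    lt_of_lt_of_le (lt_of_lt_of_le (Nat.lt_succ_self _) hn) (Nat.lt_two_pow_self).le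
  have hXlt : ∀ ρ ∈ T, X ρ < 2 ^ n := fun ρ hρ =>
    lt_of_le_of_lt ((Finset.le_sup (f := X) hρ).trans (Nat.le_add_right _ _)) h2n
  have hYlt : ∀ ρ ∈ T, ∀ ρ' ∈ T, Y ρ ρ' < 2 ^ n := fun ρ hρ ρ' hρ' =>
    lt_of_le_of_lt (((Finset.le_sup (f := Y ρ) hρ').trans
      (Finset.le_sup (f := fun ρ => T.sup (Y ρ)) hρ)).trans (Nat.le_add_left _ _)) h2n
  set M := (Matrix.of fun r c : Fin n → Bool =>
      (((liouville (Nat.ofBits (fun k : Fin (2 * n) => Sum.elim r c (π.symm k)) + 1) : ℤ) : ℂ)))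
    with hM
  -- entries are `±1`
  have hpm : ∀ r c, M r c = 1 ∨ M r c = -1 := by
    intro r c
    rw [hM, Matrix.of_apply, liouville_apply (Nat.succ_ne_zero _)]
    rcases neg_one_pow_eq_or ℤ
        (cardFactors (Nat.ofBits (fun k : Fin (2 * n) => Sum.elim r c (π.symm k)) + 1)) with h | h
    · left; rw [h]; norm_num
    · right; rw [h]; norm_num
  -- the entry at (bits of x, bits of y) is `A x y`
  have hbits : ∀ x < 2 ^ n, Nat.ofBits (fun i : Fin n => x.testBit i) = x := fun x hx => by
    rw [Nat.ofBits_testBit, Nat.mod_eq_of_lt hx]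
  have hentry : ∀ x < 2 ^ n, ∀ y < 2 ^ n,
      M (fun i : Fin n => x.testBit i) (fun i : Fin n => y.testBit i) =
        ((liouville (1 + 2 * e x + e y) : ℤ) : ℂ) := by
    intro x hx y hy
    rw [hM, Matrix.of_apply, cutNumber_interleaved n π hπ, ← spread_ofBits e hz he0 he1,
      ← spread_ofBits e hz he0 he1, hbits x hx, hbits y hy,
      show 2 * e x + e y + 1 = 1 + 2 * e x + e y by ring]
  -- the rows indexed by the representatives are pairwise distinct
  have hinj : Set.InjOn (fun ρ : ℕ → ℤ => M (fun i : Fin n => (X ρ).testBit i)) ↑T := by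
    intro ρ hρ ρ' hρ' h
    by_contra hne
    have h1 := congrFun h (fun i : Fin n => (Y ρ ρ').testBit i)
    simp only at h1
    rw [hentry _ (hXlt ρ hρ) _ (hYlt ρ hρ ρ' hρ'), hentry _ (hXlt ρ' hρ') _ (hYlt ρ hρ ρ' hρ')] at h1
    have h2 : liouville (1 + 2 * e (X ρ) + e (Y ρ ρ')) = liouville (1 + 2 * e (X ρ') + e (Y ρ ρ')) := by
      exact_mod_cast h1
    have h3 := congrFun (hX ρ hρ) (Y ρ ρ')
    have h4 := congrFun (hX ρ' hρ') (Y ρ ρ')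
    rw [h3, h4] at h2
    exact hY ρ hρ ρ' hρ' hne h2
  -- count distinct rows
  have hcard : T.card ≤ (Finset.univ.image fun r : Fin n → Bool => M r).card := by
    calc T.card = (T.image fun ρ : ℕ → ℤ => M (fun i : Fin n => (X ρ).testBit i)).card :=
          (Finset.card_image_of_injOn hinj).symm
      _ ≤ (Finset.univ.image fun r : Fin n → Bool => M r).card := by
          refine Finset.card_le_card fun v hv => ?_
          obtain ⟨ρ, -, rfl⟩ := Finset.mem_image.mp hv
          exact Finset.mem_image.mpr ⟨_, Finset.mem_univ _, rfl⟩
  have hrank := card_image_row_le_two_pow_rank M hpm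
  have hle : 2 ^ W ≤ 2 ^ M.rank := hTcard ▸ hcard.trans hrank
  exact (Nat.pow_le_pow_iff_right (by norm_num)).mp hle

/-- Corollary in the quantifier shape of the crux restricted to this cut family: for every `W`, eventually
every bit-interleaving cut (there is exactly one per level; `…InterleavedKernel.exists_interleavedCut`) has
rank `≥ W`, and such cuts exist at every level. [this file] -/
theorem interleavedCutRank_exists (W : ℕ) : ∃ n₀ : ℕ, ∀ n ≥ n₀, ∃ π : Fin n ⊕ Fin n ≃ Fin (2 * n),
    (∀ i : Fin n, (π (Sum.inl i) : ℕ) = 2 * i + 1 ∧ (π (Sum.inr i) : ℕ) = 2 * i) ∧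
      W ≤ (Matrix.of fun r c : Fin n → Bool =>
        (((liouville (Nat.ofBits (fun k : Fin (2 * n) => Sum.elim r c (π.symm k)) + 1) : ℤ) : ℂ))).rank := by
  obtain ⟨n₀, hn₀⟩ := interleavedCutRank W
  refine ⟨n₀, fun n hn => ?_⟩
  obtain ⟨π, hπ⟩ := exists_interleavedCut n
  exact ⟨π, hπ, hn₀ n hn π hπ⟩

end Summit.ValiantsHypothesis.ValiantsHypothesis.Theorems.LiouvilleSarnakLiouvilleCutRank.InterleavedUnbounded

end
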